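import Literature.NumberTheory.LFunctions.MertensThirdUpperChain
import HarnessLib

/-!
# RH-FREE kernel certificate — «nothing here bears on the truth of RH»
# Rosser–Schoenfeld's (3.29) below `3 659 203`: certified run of the product upper chain, chunks 1–5
# (primes `3 → 974317`)

Topic: `Literature/NumberTheory/LFunctions`. Pure proof file (kernel computation; nothing is asserted, no definition).
Each `runK` evaluates `MertensThirdUpperChain.runD 15333` — `15333` steps along the prime table `ChainTable.table`,
each certifying the next prime `p'`, performing the comparison `cmp` behind (3.29)
`∏_{p ≤ x} p/(p−1) < e^γ log x (1 + 1/(2 log² x))` on `[p, p') ∩ [286, ∞)`, extending the enclosures of `log p'`,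
`log log p'`, and adding the upper enclosure of `log(p'/(p'−1))`. The four files `MertensThirdUpperChainRun1–4.lean`
(chunks 1–17, primes `3 → 3659203`) carry the certificate past Dusart's threshold `3 594 641`
(assembly: `MertensThirdUpperBound.lean`). The expected states were obtained by evaluating the same function compiled
(`#eval` on the Lean farm, 2026-08-28; all comparisons pass). `decide +kernel`, standard axioms only (`maxHeartbeats 0`).

## References
* J. B. Rosser, L. Schoenfeld, Illinois J. Math. 6 (1962), 64–94: Thm 8 (3.29), p. 70; §8 p. 87 (tables below 10⁸).
  [RosserSchoenfeld1962]
-/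

namespace Literature.NumberTheory.LFunctions.MertensThirdUpperChainRun

open MertensThirdUpperChain

set_option maxHeartbeats 0 in
/-- **Chunk 1 of the certified product upper run** (primes `3` to `167953`).
[cite: RosserSchoenfeld1962, Thm. 8 (3.29) and §8 p. 87] -/
theorem run1 :
    runD 15333
      initV =
    some ⟨167953, 14545117807108278801555194, 14545117807108754407928708,
        3007230996660612685221141, 3705232068526654265473678⟩ := by
  decide +kernel

set_option maxHeartbeats 0 in
/-- **Chunk 2 of the certified product upper run** (primes `167953` to `358811`).
[cite: RosserSchoenfeld1962, Thm. 8 (3.29) and §8 p. 87] -/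
theorem run2 :
    runD 15333
      ⟨167953, 14545117807108278801555194, 14545117807108754407928708,
        3007230996660612685221141, 3705232068526654265473678⟩ =
    some ⟨358811, 15462827431324419163683070, 15462827431324894770484816,
        3081197335460988240775231, 3779223283082649166867848⟩ := by
  decide +kernel

set_option maxHeartbeats 0 in
/-- **Chunk 3 of the certified product upper run** (primes `358811` to `559093`).
[cite: RosserSchoenfeld1962, Thm. 8 (3.29) and §8 p. 87] -/
theorem run3 :
    runD 15333
      ⟨358811, 15462827431324419163683070, 15462827431324894770484816,
        3081197335460988240775231, 3779223283082649166867848⟩ =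
    some ⟨559093, 15999010259644050177662852, 15999010259644525784873915,
        3122407135649707504154866, 3820313004454920202468347⟩ := by
  decide +kernel

set_option maxHeartbeats 0 in
/-- **Chunk 4 of the certified product upper run** (primes `559093` to `764719`).
[cite: RosserSchoenfeld1962, Thm. 8 (3.29) and §8 p. 87] -/
theorem run4 :
    runD 15333
      ⟨559093, 15999010259644050177662852, 15999010259644525784873915,
        3122407135649707504154866, 3820313004454920202468347⟩ =
    some ⟨764719, 16377636902363883166446018, 16377636902364358774052418,
        3150683836533455107326694, 3848568332427357091271848⟩ := by
  decide +kernel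

set_option maxHeartbeats 0 in
/-- **Chunk 5 of the certified product upper run** (primes `764719` to `974317`).
[cite: RosserSchoenfeld1962, Thm. 8 (3.29) and §8 p. 87] -/
theorem run5 :
    runD 15333
      ⟨764719, 16377636902363883166446018, 16377636902364358774052418,
        3150683836533455107326694, 3848568332427357091271848⟩ =
    some ⟨974317, 16670472908117788623345073, 16670472908118264231339505,
        3172108739028779049147925, 3870003279524479884008533⟩ := by
  decide +kernel

end Literature.NumberTheory.LFunctions.MertensThirdUpperChainRun
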